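import Mathlib
import HarnessLib
import Summits.HubbardSuperconductivity.HubbardSuperconductivity.Theorems.KLProgrammeFreeBandRadiusDerivBoxes

/-!
# Route `KLProgramme` — ENGINE crux `KLRegimeEngineV17F2` (stmt-HubbardSuperconductivity-20437), row (C) `hcertA : KlwjCertA`:
# SOUNDNESS of the `|u′|` box checker — the radius brackets from the two level comparisons and the main theorem
# (cell gate-hubbard-kl, seat p1b g19; continuation of `…FreeBandRadiusDerivBoxes`, which has the box, the integer checker and the core estimate)

* `cos_scaled_le_of_check`, `bottom_angle_facts` — cosine brackets on a box from `cos² + sin² = 1` and the bottom angle `arcsin(s1/10⁶)`;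
* `radius_le_of_check` — the UPPER radius bracket `10⁶ u ≤ q2` from the certified comparison `F(θ_*, q2/10⁶) ≥ μ` at the bottom angle
  (`u` is non-increasing in the angle on the first octant, `bandFermiRadius_antitoneOn_octant`);
* **`abs_bandFermiRadiusDeriv_le_of_check`** — `B.check r = true →` on the whole box `|u′_μ(θ)|·10⁴ ≤ r` (the LOWER radius bracket from
  `F(θ*, q1/10⁶) ≤ μ` at the top angle, resp. at `π/4` for a `top` box, then `abs_bandFermiRadiusDeriv_le_core`).
Elementary; nothing about the Hubbard model is asserted. [folklore]
-/

noncomputable section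

namespace Summit.HubbardSuperconductivity.HubbardSuperconductivity.Theorems.PerturbedFermiCurve

set_option linter.dupNamespace false -- summit = problem name (single-conjunct summit), D-0017

open Real Set Literature.MathematicalPhysics.QuantumLattice

section Sound

variable {μ : ℝ} (hμ₁ : -4 < μ) (hμ₂ : μ < 0)
include hμ₁ hμ₂

omit hμ₁ hμ₂ in
/-- Cosine bound from above on the box: `10⁶ cos θ ≤ c2` from `10¹² ≤ c2² + s1²` and `s1 ≤ 10⁶ sin θ`. -/
theorem cos_scaled_le_of_check {c2 s1 : ℕ} (h6 : 10 ^ 12 ≤ c2 * c2 + s1 * s1) {θ : ℝ} (hθ : θ ∈ Icc 0 (π / 4))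
    (hs1 : (s1 : ℝ) ≤ Real.sin θ * 10 ^ 6) : Real.cos θ * 10 ^ 6 ≤ c2 := by
  obtain ⟨hsθ, _, hc⟩ := octant_trig hθ
  have h6' : (10:ℝ) ^ 12 ≤ (c2 : ℝ) * c2 + (s1 : ℝ) * s1 := by exact_mod_cast h6
  have hcs := Real.cos_sq_add_sin_sq θ
  have hs1_0 : (0:ℝ) ≤ s1 := Nat.cast_nonneg _
  have hss := mul_le_mul hs1 hs1 hs1_0 (by positivity)
  have e : (Real.cos θ * 10 ^ 6) ^ 2 = 10 ^ 12 - Real.sin θ * 10 ^ 6 * (Real.sin θ * 10 ^ 6) := by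
    linear_combination (10:ℝ) ^ 12 * hcs
  have h1 : (Real.cos θ * 10 ^ 6) ^ 2 ≤ (c2 : ℝ) ^ 2 := by rw [e, sq]; linarith
  exact (pow_le_pow_iff_left₀ (by positivity) (Nat.cast_nonneg _) two_ne_zero).1 h1

omit hμ₁ hμ₂ in
/-- The bottom angle `θ_* = arcsin (s1/10⁶)` of a box: in the octant, below `θ`, with `ccheck ≤ 10⁶ cos θ_* ≤ c2`. -/
theorem bottom_angle_facts {s1 ccheck c2 : ℕ} (h5 : ccheck * ccheck + s1 * s1 ≤ 10 ^ 12) (h6 : 10 ^ 12 ≤ c2 * c2 + s1 * s1)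
    {θ : ℝ} (hθ : θ ∈ Icc 0 (π / 4)) (hs1 : (s1 : ℝ) ≤ Real.sin θ * 10 ^ 6) :
    Real.arcsin ((s1 : ℝ) / 10 ^ 6) ∈ Icc 0 (π / 4) ∧ Real.arcsin ((s1 : ℝ) / 10 ^ 6) ≤ θ ∧
      Real.sin (Real.arcsin ((s1 : ℝ) / 10 ^ 6)) = (s1 : ℝ) / 10 ^ 6 ∧
      (ccheck : ℝ) ≤ Real.cos (Real.arcsin ((s1 : ℝ) / 10 ^ 6)) * 10 ^ 6 ∧
      Real.cos (Real.arcsin ((s1 : ℝ) / 10 ^ 6)) * 10 ^ 6 ≤ c2 := by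
  obtain ⟨hsθ, hsc, hc⟩ := octant_trig hθ
  have hθ2 : θ ≤ π / 2 := by linarith [hθ.2, Real.pi_pos]
  have hs_le : Real.sin θ ≤ Real.sqrt 2 / 2 := by
    rw [← Real.sin_pi_div_four]
    exact Real.sin_le_sin_of_le_of_le_pi_div_two (by linarith [hθ.1, Real.pi_pos]) (by linarith [Real.pi_pos]) hθ.2
  have hsq := sqrt_two_div_two_lt
  set σ : ℝ := (s1 : ℝ) / 10 ^ 6 with hσ
  have hσ0 : 0 ≤ σ := by positivity
  have hσs : σ ≤ Real.sin θ := by rw [hσ, div_le_iff₀ (by norm_num : (0:ℝ) < 10 ^ 6)]; exact hs1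
  have hσ1 : σ ≤ 1 := by linarith
  have hle : Real.arcsin σ ≤ θ := arcsin_le_of_le_sin hθ.1 hθ2 hσ0 hσ1 hσs
  have h0 : 0 ≤ Real.arcsin σ := Real.arcsin_nonneg.2 hσ0
  have hsin : Real.sin (Real.arcsin σ) = σ := Real.sin_arcsin (by linarith) hσ1
  have hcos : Real.cos (Real.arcsin σ) = Real.sqrt (1 - σ ^ 2) := Real.cos_arcsin σ
  have h5' : (ccheck : ℝ) * ccheck + (s1 : ℝ) * s1 ≤ 10 ^ 12 := by exact_mod_cast h5
  have h6' : (10:ℝ) ^ 12 ≤ (c2 : ℝ) * c2 + (s1 : ℝ) * s1 := by exact_mod_cast h6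
  have e2 : σ ^ 2 = (s1 : ℝ) * s1 / 10 ^ 12 := by rw [hσ]; ring
  refine ⟨⟨h0, hle.trans hθ.2⟩, hle, hsin, ?_, ?_⟩
  · rw [hcos]
    have h1 : ((ccheck : ℝ) / 10 ^ 6) ^ 2 ≤ 1 - σ ^ 2 := by
      have e1 : ((ccheck : ℝ) / 10 ^ 6) ^ 2 = (ccheck : ℝ) * ccheck / 10 ^ 12 := by ring
      have h3 : (ccheck : ℝ) * ccheck / 10 ^ 12 + (s1 : ℝ) * s1 / 10 ^ 12 ≤ 1 := by
        rw [← add_div, div_le_one (by positivity)]; exact h5'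
      rw [e1, e2]; linarith
    have h2 : (ccheck : ℝ) / 10 ^ 6 ≤ Real.sqrt (1 - σ ^ 2) := by
      rw [← Real.sqrt_sq (by positivity : (0:ℝ) ≤ (ccheck : ℝ) / 10 ^ 6)]
      exact Real.sqrt_le_sqrt h1
    rw [div_le_iff₀ (by norm_num : (0:ℝ) < 10 ^ 6)] at h2; exact h2
  · rw [hcos]
    have h1 : 1 - σ ^ 2 ≤ ((c2 : ℝ) / 10 ^ 6) ^ 2 := by
      have e1 : ((c2 : ℝ) / 10 ^ 6) ^ 2 = (c2 : ℝ) * c2 / 10 ^ 12 := by ring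
      have h3 : 1 ≤ (c2 : ℝ) * c2 / 10 ^ 12 + (s1 : ℝ) * s1 / 10 ^ 12 := by
        rw [← add_div, one_le_div (by positivity)]; exact h6'
      rw [e1, e2]; linarith
    have h2 : Real.sqrt (1 - σ ^ 2) ≤ (c2 : ℝ) / 10 ^ 6 := by
      rw [← Real.sqrt_sq (by positivity : (0:ℝ) ≤ (c2 : ℝ) / 10 ^ 6)]
      exact Real.sqrt_le_sqrt h1
    rw [le_div_iff₀ (by norm_num : (0:ℝ) < 10 ^ 6)] at h2; exact h2

set_option maxHeartbeats 400000 in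
/-- **Upper radius bracket** from the bottom-angle comparison `F(θ_*, q2) ≥ μ`. -/
theorem radius_le_of_check {B : R1Box}
    (h5 : B.ccheck * B.ccheck + B.s1 * B.s1 ≤ 10 ^ 12) (h6 : 10 ^ 12 ≤ B.c2 * B.c2 + B.s1 * B.s1)
    (h7 : B.q2 * B.c2 ≤ 3141592000000)
    (h12 : B.m2 * (479001600 * 10 ^ 144) ≤ -2 * (fpCosHi (B.q2 * B.ccheck) + fpCosHi (B.q2 * B.s1)) * 10 ^ 6)
    (hm2 : μ * 10 ^ 6 ≤ (B.m2 : ℝ)) {θ : ℝ} (hθ : θ ∈ Icc 0 (π / 4)) (hs1 : (B.s1 : ℝ) ≤ Real.sin θ * 10 ^ 6) :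
    bandFermiRadius μ θ * 10 ^ 6 ≤ B.q2 := by
  have hπ1 := Real.pi_gt_d6
  obtain ⟨hmem, hle, hsin, hcc, hc2⟩ := bottom_angle_facts h5 h6 hθ hs1
  obtain ⟨_, _, hc0⟩ := octant_trig hmem
  have hanti : bandFermiRadius μ θ ≤ bandFermiRadius μ (Real.arcsin ((B.s1 : ℝ) / 10 ^ 6)) :=
    bandFermiRadius_antitoneOn_octant hμ₁ hμ₂ hmem hθ hle
  generalize hθ₀ : Real.arcsin ((B.s1 : ℝ) / 10 ^ 6) = θ₀ at hmem hle hsin hcc hc2 hc0 hanti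
  have hq0 : (0 : ℝ) ≤ (B.q2 : ℝ) / 10 ^ 6 := by positivity
  have h7' : (B.q2 : ℝ) * B.c2 ≤ 3141592000000 := by exact_mod_cast h7
  have hqcos : (B.q2 : ℝ) / 10 ^ 6 * Real.cos θ₀ ≤ 3.141592 := by
    have h1 : (B.q2 : ℝ) / 10 ^ 6 * (Real.cos θ₀ * 10 ^ 6) ≤ (B.q2 : ℝ) / 10 ^ 6 * (B.c2 : ℝ) :=
      mul_le_mul_of_nonneg_left hc2 hq0
    have e1 : (B.q2 : ℝ) / 10 ^ 6 * (Real.cos θ₀ * 10 ^ 6) = (B.q2 : ℝ) * Real.cos θ₀ := by ring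
    have e2 : (B.q2 : ℝ) / 10 ^ 6 * (B.c2 : ℝ) = (B.q2 : ℝ) * B.c2 / 10 ^ 6 := by ring
    rw [e1, e2] at h1
    have h2 : (B.q2 : ℝ) * B.c2 / 10 ^ 6 ≤ 3141592 := by
      rw [div_le_iff₀ (by norm_num : (0:ℝ) < 10 ^ 6)]; linarith
    have h3 : (B.q2 : ℝ) * Real.cos θ₀ ≤ 3141592 := h1.trans h2
    have e3 : (B.q2 : ℝ) / 10 ^ 6 * Real.cos θ₀ = (B.q2 : ℝ) * Real.cos θ₀ / 10 ^ 6 := by ring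
    rw [e3, div_le_iff₀ (by norm_num : (0:ℝ) < 10 ^ 6)]; linarith
  have hqπ : (B.q2 : ℝ) / 10 ^ 6 * ‖dir θ₀‖ ≤ π := by rw [norm_dir_of_mem_octant hmem]; linarith
  have hcomp : μ ≤ rayDispersion (θ₀, (B.q2 : ℝ) / 10 ^ 6) := by
    rw [rayDispersion_eq]
    simp only [hsin]
    have hx0 : (0 : ℝ) ≤ ((B.q2 * B.ccheck : ℕ) : ℝ) / 10 ^ 12 := by positivity
    have hxy : ((B.q2 * B.ccheck : ℕ) : ℝ) / 10 ^ 12 ≤ (B.q2 : ℝ) / 10 ^ 6 * Real.cos θ₀ := by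
      rw [Nat.cast_mul, div_le_iff₀ (by norm_num : (0:ℝ) < 10 ^ 12)]
      have h1 : (B.q2 : ℝ) * (B.ccheck : ℝ) ≤ (B.q2 : ℝ) * (Real.cos θ₀ * 10 ^ 6) :=
        mul_le_mul_of_nonneg_left hcc (Nat.cast_nonneg _)
      have e : (B.q2 : ℝ) / 10 ^ 6 * Real.cos θ₀ * 10 ^ 12 = (B.q2 : ℝ) * (Real.cos θ₀ * 10 ^ 6) := by ring
      rw [e]; exact h1
    have hyπ : (B.q2 : ℝ) / 10 ^ 6 * Real.cos θ₀ ≤ π := by linarith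
    have hcos1 : Real.cos ((B.q2 : ℝ) / 10 ^ 6 * Real.cos θ₀) ≤ Real.cos (((B.q2 * B.ccheck : ℕ) : ℝ) / 10 ^ 12) :=
      Real.cos_le_cos_of_nonneg_of_le_pi hx0 hyπ hxy
    have hT1 := cos_le_fpCosHi (B.q2 * B.ccheck)
    have hT2 := cos_le_fpCosHi (B.q2 * B.s1)
    have e2 : (B.q2 : ℝ) / 10 ^ 6 * ((B.s1 : ℝ) / 10 ^ 6) = ((B.q2 * B.s1 : ℕ) : ℝ) / 10 ^ 12 := by
      rw [Nat.cast_mul]; ring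
    rw [e2]
    have h12' : (B.m2 : ℝ) * (479001600 * 10 ^ 144) ≤
        -2 * (((fpCosHi (B.q2 * B.ccheck) : ℤ) : ℝ) + ((fpCosHi (B.q2 * B.s1) : ℤ) : ℝ)) * 10 ^ 6 := by
      exact_mod_cast h12
    linarith only [hcos1, hT1, hT2, h12', hm2]
  have hle2 : bandFermiRadius μ θ₀ ≤ (B.q2 : ℝ) / 10 ^ 6 :=
    bandFermiRadius_le_of_le_rayDispersion hμ₁ hμ₂ hq0 hqπ hcomp
  rw [le_div_iff₀ (by norm_num : (0:ℝ) < 10 ^ 6)] at hle2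
  linarith

set_option maxHeartbeats 800000 in
/-- **SOUNDNESS OF THE BOX CHECKER.**  If `B.check r = true` then for every level `μ ∈ [m1, m2]/10⁶` (`-4 < μ < 0`) and every angle
`θ ∈ [0, π/4]` of the box (`s1/10⁶ ≤ sin θ`, and `sin θ ≤ s2/10⁶ unless `top`), `|u′_μ(θ)|·10⁴ ≤ r`. -/
theorem abs_bandFermiRadiusDeriv_le_of_check {r : ℕ} {B : R1Box} (hB : B.check r = true)
    (hm1 : (B.m1 : ℝ) ≤ μ * 10 ^ 6) (hm2 : μ * 10 ^ 6 ≤ (B.m2 : ℝ)) {θ : ℝ} (hθ : θ ∈ Icc 0 (π / 4))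
    (hs1 : (B.s1 : ℝ) ≤ Real.sin θ * 10 ^ 6) (hs2 : B.top = false → Real.sin θ * 10 ^ 6 ≤ (B.s2 : ℝ)) :
    |bandFermiRadiusDeriv μ θ| * 10 ^ 4 ≤ r := by
  have hπ1 := Real.pi_gt_d6
  have hπ2 := Real.pi_lt_d6
  obtain ⟨hsθ, hsc, hc⟩ := octant_trig hθ
  have hθ2 : θ ≤ π / 2 := by linarith [hθ.2, Real.pi_pos]
  have hcs : Real.cos θ ^ 2 + Real.sin θ ^ 2 = 1 := Real.cos_sq_add_sin_sq θ
  have hs_le : Real.sin θ ≤ Real.sqrt 2 / 2 := by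
    rw [← Real.sin_pi_div_four]
    exact Real.sin_le_sin_of_le_of_le_pi_div_two (by linarith [hθ.1]) (by linarith) hθ.2
  have hc_ge : Real.sqrt 2 / 2 ≤ Real.cos θ := by
    rw [← Real.cos_pi_div_four]
    exact Real.cos_le_cos_of_nonneg_of_le_pi hθ.1 (by linarith) hθ.2
  have hsq2 : (Real.sqrt 2 / 2) ^ 2 = 1 / 2 := by
    rw [div_pow, Real.sq_sqrt (by norm_num)]; norm_num
  have hsqlt := sqrt_two_div_two_lt
  have hu0 : 0 < bandFermiRadius μ θ := bandFermiRadius_pos hμ₁ hμ₂ θ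
  cases htop : B.top <;>
    simp only [R1Box.check, htop, Bool.false_eq_true, ↓reduceIte, Bool.and_eq_true, decide_eq_true_eq,
      and_assoc] at hB
  · -- non-top box
    obtain ⟨h1, h2, h3, h4, h5, h6, h7, h8, h9, h10, h11, h12, h13, h14, h15, h16⟩ := hB
    have hs2' : Real.sin θ * 10 ^ 6 ≤ (B.s2 : ℝ) := hs2 htop
    have hc2r := cos_scaled_le_of_check h6 hθ hs1
    have hq2r := radius_le_of_check hμ₁ hμ₂ h5 h6 h7 h12 hm2 hθ hs1
    -- c1 ≤ 10⁶ cos θ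
    have h2' : (B.c1 : ℝ) * B.c1 + (B.s2 : ℝ) * B.s2 ≤ 10 ^ 12 := by exact_mod_cast h2
    have hc1r : (B.c1 : ℝ) ≤ Real.cos θ * 10 ^ 6 := by
      have hss := mul_le_mul hs2' hs2' (by positivity) (Nat.cast_nonneg _)
      have e : (Real.cos θ * 10 ^ 6) ^ 2 = 10 ^ 12 - Real.sin θ * 10 ^ 6 * (Real.sin θ * 10 ^ 6) := by
        linear_combination (10:ℝ) ^ 12 * hcs
      have h1 : (B.c1 : ℝ) ^ 2 ≤ (Real.cos θ * 10 ^ 6) ^ 2 := by rw [e, sq]; linarith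
      exact (pow_le_pow_iff_left₀ (Nat.cast_nonneg _) (by positivity) two_ne_zero).1 h1
    -- lower radius bracket from the top-angle comparison
    have h4' : 2 * ((B.s2 : ℝ) * B.s2) ≤ 10 ^ 12 := by exact_mod_cast h4
    have h3' : (10:ℝ) ^ 12 ≤ (B.chat : ℝ) * B.chat + (B.s2 : ℝ) * B.s2 := by exact_mod_cast h3
    have hσ0 : (0 : ℝ) ≤ (B.s2 : ℝ) / 10 ^ 6 := by positivity
    have eσ : ((B.s2 : ℝ) / 10 ^ 6) ^ 2 = (B.s2 : ℝ) * B.s2 / 10 ^ 12 := by ring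
    have hσ2 : (B.s2 : ℝ) / 10 ^ 6 ≤ Real.sqrt 2 / 2 := by
      have : ((B.s2 : ℝ) / 10 ^ 6) ^ 2 ≤ (Real.sqrt 2 / 2) ^ 2 := by
        rw [hsq2, eσ, div_le_iff₀ (by positivity)]; linarith
      exact (pow_le_pow_iff_left₀ hσ0 (by positivity) two_ne_zero).1 this
    have hσ1 : (B.s2 : ℝ) / 10 ^ 6 ≤ 1 := by linarith
    have hθ₁0 : 0 ≤ Real.arcsin ((B.s2 : ℝ) / 10 ^ 6) := Real.arcsin_nonneg.2 hσ0
    have hθ₁4 : Real.arcsin ((B.s2 : ℝ) / 10 ^ 6) ≤ π / 4 := by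
      rw [Real.arcsin_le_iff_le_sin ⟨by linarith, hσ1⟩ ⟨by linarith [Real.pi_pos], by linarith [Real.pi_pos]⟩,
        Real.sin_pi_div_four]
      exact hσ2
    have hθ₁mem : Real.arcsin ((B.s2 : ℝ) / 10 ^ 6) ∈ Icc 0 (π / 4) := ⟨hθ₁0, hθ₁4⟩
    have hθle : θ ≤ Real.arcsin ((B.s2 : ℝ) / 10 ^ 6) := le_arcsin_of_sin_le hθ.1 hθ2 (by linarith) hσ1
      (by rw [le_div_iff₀ (by norm_num : (0:ℝ) < 10 ^ 6)]; exact hs2')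
    have hsin₁ : Real.sin (Real.arcsin ((B.s2 : ℝ) / 10 ^ 6)) = (B.s2 : ℝ) / 10 ^ 6 := Real.sin_arcsin (by linarith) hσ1
    have hcos₁ : Real.cos (Real.arcsin ((B.s2 : ℝ) / 10 ^ 6)) = Real.sqrt (1 - ((B.s2 : ℝ) / 10 ^ 6) ^ 2) :=
      Real.cos_arcsin _
    have hanti : bandFermiRadius μ (Real.arcsin ((B.s2 : ℝ) / 10 ^ 6)) ≤ bandFermiRadius μ θ :=
      bandFermiRadius_antitoneOn_octant hμ₁ hμ₂ hθ hθ₁mem hθle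
    obtain ⟨_, _, hc₁0⟩ := octant_trig hθ₁mem
    generalize hθ₁ : Real.arcsin ((B.s2 : ℝ) / 10 ^ 6) = θ₁ at hθ₁mem hsin₁ hcos₁ hanti hc₁0
    have hchat : Real.cos θ₁ * 10 ^ 6 ≤ B.chat := by
      rw [hcos₁]
      have h1 : 1 - ((B.s2 : ℝ) / 10 ^ 6) ^ 2 ≤ ((B.chat : ℝ) / 10 ^ 6) ^ 2 := by
        have e1 : ((B.chat : ℝ) / 10 ^ 6) ^ 2 = (B.chat : ℝ) * B.chat / 10 ^ 12 := by ring
        have h3 : 1 ≤ (B.chat : ℝ) * B.chat / 10 ^ 12 + (B.s2 : ℝ) * B.s2 / 10 ^ 12 := by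
          rw [← add_div, one_le_div (by positivity)]; exact h3'
        rw [e1, eσ]; linarith
      have h2 : Real.sqrt (1 - ((B.s2 : ℝ) / 10 ^ 6) ^ 2) ≤ (B.chat : ℝ) / 10 ^ 6 := by
        rw [← Real.sqrt_sq (by positivity : (0:ℝ) ≤ (B.chat : ℝ) / 10 ^ 6)]
        exact Real.sqrt_le_sqrt h1
      rw [le_div_iff₀ (by norm_num : (0:ℝ) < 10 ^ 6)] at h2; exact h2
    have hq0 : (0 : ℝ) ≤ (B.q1 : ℝ) / 10 ^ 6 := by positivity
    have h10' : (B.q1 : ℝ) * B.chat ≤ 3141592000000 := by exact_mod_cast h10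
    have hqcos : (B.q1 : ℝ) / 10 ^ 6 * Real.cos θ₁ ≤ 3.141592 := by
      have h1 : (B.q1 : ℝ) * (Real.cos θ₁ * 10 ^ 6) ≤ (B.q1 : ℝ) * (B.chat : ℝ) :=
        mul_le_mul_of_nonneg_left hchat (Nat.cast_nonneg _)
      have e3 : (B.q1 : ℝ) / 10 ^ 6 * Real.cos θ₁ = (B.q1 : ℝ) * (Real.cos θ₁ * 10 ^ 6) / 10 ^ 12 := by ring
      rw [e3, div_le_iff₀ (by norm_num : (0:ℝ) < 10 ^ 12)]; linarith
    have hqπ : (B.q1 : ℝ) / 10 ^ 6 * ‖dir θ₁‖ ≤ π := by rw [norm_dir_of_mem_octant hθ₁mem]; linarith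
    have hcomp : rayDispersion (θ₁, (B.q1 : ℝ) / 10 ^ 6) ≤ μ := by
      rw [rayDispersion_eq]
      simp only [hsin₁]
      have hx0 : 0 ≤ (B.q1 : ℝ) / 10 ^ 6 * Real.cos θ₁ := by positivity
      have hxy : (B.q1 : ℝ) / 10 ^ 6 * Real.cos θ₁ ≤ ((B.q1 * B.chat : ℕ) : ℝ) / 10 ^ 12 := by
        rw [Nat.cast_mul, le_div_iff₀ (by norm_num : (0:ℝ) < 10 ^ 12)]
        have h1 : (B.q1 : ℝ) * (Real.cos θ₁ * 10 ^ 6) ≤ (B.q1 : ℝ) * (B.chat : ℝ) :=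
          mul_le_mul_of_nonneg_left hchat (Nat.cast_nonneg _)
        have e : (B.q1 : ℝ) / 10 ^ 6 * Real.cos θ₁ * 10 ^ 12 = (B.q1 : ℝ) * (Real.cos θ₁ * 10 ^ 6) := by ring
        rw [e]; exact h1
      have hyπ : ((B.q1 * B.chat : ℕ) : ℝ) / 10 ^ 12 ≤ π := by
        rw [Nat.cast_mul, div_le_iff₀ (by norm_num : (0:ℝ) < 10 ^ 12)]; linarith
      have hcos1 : Real.cos (((B.q1 * B.chat : ℕ) : ℝ) / 10 ^ 12) ≤ Real.cos ((B.q1 : ℝ) / 10 ^ 6 * Real.cos θ₁) :=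
        Real.cos_le_cos_of_nonneg_of_le_pi hx0 hyπ hxy
      have hT1 := fpCosLo_le (B.q1 * B.chat)
      have hT2 := fpCosLo_le (B.q1 * B.s2)
      have e2 : (B.q1 : ℝ) / 10 ^ 6 * ((B.s2 : ℝ) / 10 ^ 6) = ((B.q1 * B.s2 : ℕ) : ℝ) / 10 ^ 12 := by
        rw [Nat.cast_mul]; ring
      rw [e2]
      have h11' : -2 * (((fpCosLo (B.q1 * B.chat) : ℤ) : ℝ) + ((fpCosLo (B.q1 * B.s2) : ℤ) : ℝ)) * 10 ^ 6 ≤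
          (B.m1 : ℝ) * (87178291200 * 10 ^ 168) := by exact_mod_cast h11
      linarith only [hcos1, hT1, hT2, h11', hm1]
    have hge : (B.q1 : ℝ) / 10 ^ 6 ≤ bandFermiRadius μ θ₁ :=
      le_bandFermiRadius_of_rayDispersion_le hμ₁ hμ₂ hq0 hqπ hcomp
    have hq1r : (B.q1 : ℝ) ≤ bandFermiRadius μ θ * 10 ^ 6 := by
      rw [div_le_iff₀ (by norm_num : (0:ℝ) < 10 ^ 6)] at hge; linarith
    exact abs_bandFermiRadiusDeriv_le_core hμ₁ hμ₂ r B h7 h8 h13 h14 h16 hθ hq1r hq2r hc1r hc2r hs1 hs2'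
  · -- top box
    obtain ⟨h1, h2, h3, h5, h6, h7, h8, h9, h10, h12, h13, h14, h15, h16⟩ := hB
    have hc2r := cos_scaled_le_of_check h6 hθ hs1
    have hq2r := radius_le_of_check hμ₁ hμ₂ h5 h6 h7 h12 hm2 hθ hs1
    have h2' : 2 * ((B.c1 : ℝ) * B.c1) ≤ 10 ^ 12 := by exact_mod_cast h2
    have h3' : (10:ℝ) ^ 12 ≤ 2 * ((B.s2 : ℝ) * B.s2) := by exact_mod_cast h3
    have esq : Real.sqrt 2 / 2 * (Real.sqrt 2 / 2) = 1 / 2 := by rw [← sq, hsq2]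
    have hc1r : (B.c1 : ℝ) ≤ Real.cos θ * 10 ^ 6 := by
      have hcc := mul_le_mul hc_ge hc_ge (by positivity) hc.le
      rw [esq] at hcc
      have e : (Real.cos θ * 10 ^ 6) ^ 2 = Real.cos θ * Real.cos θ * 10 ^ 12 := by ring
      have h1 : (B.c1 : ℝ) ^ 2 ≤ (Real.cos θ * 10 ^ 6) ^ 2 := by rw [e, sq]; linarith
      exact (pow_le_pow_iff_left₀ (Nat.cast_nonneg _) (by positivity) two_ne_zero).1 h1
    have hs2' : Real.sin θ * 10 ^ 6 ≤ (B.s2 : ℝ) := by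
      have hss := mul_le_mul hs_le hs_le hsθ (by positivity)
      rw [esq] at hss
      have e : (Real.sin θ * 10 ^ 6) ^ 2 = Real.sin θ * Real.sin θ * 10 ^ 12 := by ring
      have h1 : (Real.sin θ * 10 ^ 6) ^ 2 ≤ (B.s2 : ℝ) ^ 2 := by rw [e, sq]; linarith
      exact (pow_le_pow_iff_left₀ (by positivity) (Nat.cast_nonneg _) two_ne_zero).1 h1
    -- lower radius bracket from the comparison at `π/4`
    have hanti : bandFermiRadius μ (π / 4) ≤ bandFermiRadius μ θ := bandFermiRadius_pi_div_four_le hμ₁ hμ₂ hθ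
    have hq0 : (0 : ℝ) ≤ (B.q1 : ℝ) / 10 ^ 6 := by positivity
    have h9' : (B.q1 : ℝ) ≤ 4000000 := by exact_mod_cast h9
    have hq4 : (B.q1 : ℝ) / 10 ^ 6 ≤ 4 := by rw [div_le_iff₀ (by norm_num : (0:ℝ) < 10 ^ 6)]; linarith
    have hn4 : ‖dir (π / 4)‖ = Real.sqrt 2 / 2 := by
      rw [norm_dir_of_mem_octant ⟨by positivity, le_rfl⟩, Real.cos_pi_div_four]
    have hqπ : (B.q1 : ℝ) / 10 ^ 6 * ‖dir (π / 4)‖ ≤ π := by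
      rw [hn4]
      have := mul_le_mul hq4 hsqlt.le (by positivity) (by norm_num)
      linarith
    have hcomp : rayDispersion (π / 4, (B.q1 : ℝ) / 10 ^ 6) ≤ μ := by
      rw [rayDispersion_eq]
      simp only [Real.cos_pi_div_four, Real.sin_pi_div_four]
      have hx0 : 0 ≤ (B.q1 : ℝ) / 10 ^ 6 * (Real.sqrt 2 / 2) := by positivity
      have hx2 : ((B.q1 : ℝ) / 10 ^ 6 * (Real.sqrt 2 / 2)) ^ 2 = ((B.q1 * B.q1 : ℕ) : ℝ) / (2 * 10 ^ 12) := by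
        rw [mul_pow, hsq2, Nat.cast_mul]; ring
      have hT := fpCosLoTop_le (B.q1 * B.q1) hx0 hx2
      have h10' : -4 * ((fpCosLoTop (B.q1 * B.q1) : ℤ) : ℝ) * 10 ^ 6 ≤ (B.m1 : ℝ) * (87178291200 * 128 * 10 ^ 84) := by
        exact_mod_cast h10
      linarith only [hT, h10', hm1]
    have hge : (B.q1 : ℝ) / 10 ^ 6 ≤ bandFermiRadius μ (π / 4) :=
      le_bandFermiRadius_of_rayDispersion_le hμ₁ hμ₂ hq0 hqπ hcomp
    have hq1r : (B.q1 : ℝ) ≤ bandFermiRadius μ θ * 10 ^ 6 := by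
      rw [div_le_iff₀ (by norm_num : (0:ℝ) < 10 ^ 6)] at hge; linarith
    exact abs_bandFermiRadiusDeriv_le_core hμ₁ hμ₂ r B h7 h8 h13 h14 h16 hθ hq1r hq2r hc1r hc2r hs1 hs2'

end Sound

end Summit.HubbardSuperconductivity.HubbardSuperconductivity.Theorems.PerturbedFermiCurve
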